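import Mathlib.RingTheory.SimpleModule.Isotypic
import Mathlib.RingTheory.Nakayama
import Mathlib.RingTheory.Artinian.Module
import Mathlib.RingTheory.LocalRing.ResidueField.Basic
import Mathlib.RingTheory.FiniteLength
import Mathlib.LinearAlgebra.Pi
import Mathlib.LinearAlgebra.Quotient.Basic
import Mathlib.LinearAlgebra.Basis.VectorSpace
import Mathlib.Algebra.Module.Torsion.Basic
import Mathlib.Algebra.Category.ModuleCat.Basic
import Literature.Barriers.Langlands.ModPLanglandsGL2BeyondQp
import Literature.NumberTheory.Automorphic.Socle
import Literature.NumberTheory.Automorphic.ReductiveGroupData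
import HarnessLib

/-!
# Barrier (Langlands, `GL₂` over totally real fields): Paškūnas' Bernstein-centre finiteness fails for `GL₂(F)`, `F ≠ ℚ_p` — one weight block of `GL₂(ℚ_{p^f})`, `f ≥ 2`, already contains infinitely many supersingular representations

Barrier catalogue entry (D-0021) for the summit `Langlands`, refining
`Literature.Barriers.Langlands.BreuilPaskunas2012_supersingularFamily` (file `ModPLanglandsGL2BeyondQp`)
to the form in which it obstructs the BERNSTEIN-CENTRE method.  For `G = GL₂(ℚ_p)`, `p ≥ 5`,
Paškūnas decomposes the category of locally finite smooth representations with a central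
character into blocks `𝔅` (finite sets of irreducibles), makes each block anti-equivalent to the
compact modules over `Ẽ_𝔅 = End_G(J_𝔅)` (`J_𝔅` an injective envelope of `⊕_{π ∈ 𝔅} π`), and
proves that the centre of `Ẽ_𝔅` — the Bernstein centre
of the block — is the pseudo-deformation ring `R^{ps}` of the attached `tr ρ̄` and that `Ẽ_𝔅` is a
finitely generated module over it; this is the local input by which Pan (and X. Zhang) make the
completed cohomology of a definite quaternion algebra finite over the big Hecke algebra and get
the finite map `⊗̂_{v∣p} R_v^{ps} → 𝕋_𝔪`, at places with `F_v = ℚ_p`.  For `F = ℚ_{p^f}` with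
`f ≥ 2` the printed theorems of Breuil–Paškūnas already put infinitely many pairwise
non-isomorphic irreducible admissible supersingular representations into ONE "weight block"
(common central character, common `GL₂(𝒪_F)`-socle `⊕_{σ ∈ 𝒟(ρ̄)} σ`), and a class of
representations parametrised, injectively up to isomorphism, by simple modules over an algebra
that is module-finite over a commutative local ring is finite (elementary; proved in this file).
Hence no Paškūnas-type "finite centre" structure exists on any class of representations
containing that family: the typed no-go `PaskunasCentreFinitenessFails.isEmpty_finiteCentreParametrisation`,
PROVED here from the named fact `PaskunasCentreFinitenessFails` (the printed infinitude in block
form, SIZE XL like its parent fact) and the algebra below.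

## What the sources print

* Paškūnas, *The image of Colmez's Montreal functor*, Publ. IHÉS 118 (2013), for `G = GL₂(ℚ_p)`,
  `p ≥ 5`: §1.1 — blocks `𝔅` of `Mod^{l.fin}_{G,ζ}(𝒪)` (equivalence classes of irreducibles under
  `Ext¹ ≠ 0`), Gabriel's decomposition `Mod^{l.fin}_{G,ζ}(𝒪) ≅ ∏_𝔅 Mod^{l.fin}_{G,ζ}(𝒪)^𝔅`, and
  "the functor `τ ↦ Hom_G(τ, J_𝔅)` induces an anti-equivalence of categories between
  `Mod^{l.fin}_{G,ζ}(𝒪)^𝔅` and the category of compact `Ẽ_𝔅`-modules", the blocks being the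
  finite sets (i)–(iv) (at most three irreducibles); Thm. 1.5: "the centre of `Ẽ_𝔅` and hence
  the centre of the category `Mod^{l.fin}_{G,ζ}(𝒪)^𝔅` is naturally isomorphic to
  `R^{ps,ζε}_{tr ρ}`", followed by "We also show that `Ẽ_𝔅` is finitely generated as a module
  over its centre"; Prop. 1.16 / Thm. 1.17 (general `p`-adic analytic `G`): finiteness results
  under the hypothesis "the centre `𝒵` of `Ẽ` is noetherian and `Ẽ` is a finitely generated
  `𝒵`-module"; §1.4 ("A speculation"): "It is well known … that if `G ≠ GL₂(ℚ_p)` then there are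
  too many representations of `G` to have a correspondence with Galois representations", the
  remedy envisaged being that "a global setting … cuts out a full subcategory" for which "results
  similar to those described in §1.1 hold". [cite: Paskunas2013, Thm. 1.5]
* Breuil–Paškūnas, *Towards a modulo `p` Langlands correspondence for `GL₂`*, Mem. AMS 216
  (2012) (page numbers of the authors' version `supersingular.pdf`, 122 pp., whose numbering the
  citing literature uses): §1 p. 3 — the aim is "to associate to `ρ` a (usually infinite) family of
  smooth admissible representations `π` of `GL₂(F)` over `𝔽̄_p` with fixed central character
  (matching `det(ρ)` via local class field theory)"; "when `f > 1`, this is not possible anymore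
  as the family becomes much too big"; p. 7: "Up to isomorphisms of commutative diagrams, it turns
  out there are infinitely many such injections as soon as `f > 1`"; p. 9: refinements "probably
  still not enough to select, e.g., a finite subset of representations in the above infinite
  family … (if `F ≠ ℚ_p`)"; §13 p. 75: "We associate to each generic `ρ` … a 'family' of basic
  `0`-diagrams … When `f > 1`, this family is always infinite" (explicit parameter counts in §16,
  pp. 92–95); Thm. 19.8 (p. 113): for `ρ` generic with `p` acting trivially on `det ρ` and each
  diagram `(D₀(ρ), D₁(ρ), r)`, "(i) There exists a smooth admissible representation `π` of `G` such
  that: (a) `soc_K π = ⊕_{σ ∈ 𝒟(ρ)} σ` (b) `(π^{K₁}, π^{I₁}, can) ↩ (D₀(ρ), D₁(ρ), r)` (c) `π` is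
  generated by `D₀(ρ)`. (ii) If … `r` and … `r'` are two non-isomorphic basic `0`-diagrams
  associated to `ρ` … then `π` and `π'` are non-isomorphic"; Thm. 19.10 (i) (p. 114): "assume `ρ`
  is irreducible. Then any `π` satisfying (a), (b), (c) of (i) of Theorem 19.8 is irreducible and
  is a supersingular representation"; scope: `F = ℚ_{p^f}` (§11, p. 65), `p > 2` (§19, p. 108:
  "Since there are no generic `ρ` if `p = 2` … we can assume `p > 2`"; generic irreducible `ρ`
  exist for every `p ≥ 3`, Def. 11.7 and the lines after it, p. 69), `K = GL₂(𝒪_F)` and all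
  representations over `𝔽̄_p` (§1 p. 12). [cite: BreuilPaskunas2012, Thm. 19.8 and Thm. 19.10]
* Breuil–Herzig–Hu–Morra–Schraen, *Gelfand–Kirillov dimension and mod `p` cohomology for
  `GL₂`*, Invent. Math. 234 (2023), §1.1: "if `F_v ≠ ℚ_p` the (over-)abundance of supersingular
  representations ([BP], [Hu]) makes it more difficult to obtain information"; Thm. 1.1:
  `dim_{GL₂(F_v)}(π) = f` for the `ρ̄`-part `π` of the mod `p` cohomology of a Shimura curve (or a
  totally definite quaternion algebra), `F_v` unramified, `ρ̄` generic and absolutely irreducible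
  on `G_{F(ζ_p)}`; Thm. 1.2 (`p` inert): `R_{ρ̄,S}^ψ ≅ 𝕋̂(V^v)_ρ̄`, the dual completed cohomology is
  faithfully flat over it and `𝕋̂` is a complete intersection — "This flatness was known in the
  case of modular curves using the full strength of the `p`-adic Langlands correspondence for
  `GL₂(ℚ_p)`". [cite: BreuilEtAl2023, Thm. 1.1 and Thm. 1.2]
* Gee–Newton, *Patching and the completed homology of locally symmetric spaces*, JIMJ 21
  (2022), §1: flatness of the patched module follows from "the simple codimension inequality"
  by "a version of the miracle flatness criterion"; "Even in `l₀ = 0` situations, we do not know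
  how to establish this codimension inequality … if we did, our methods would give a new approach
  to proving big `R = 𝕋` theorems in these situations. In the case `n = 2`, `F = ℚ`, the
  codimension inequality follows from Emerton's `p`-adic local–global compatibility theorem,
  together with known properties of the `p`-adic local Langlands correspondence."
  [cite: GeeNewton2020, §1]
* Pan, *The Fontaine–Mazur conjecture in the residually reducible case*, JAMS 35 (2022), §1:
  "by the work of Paškūnas, we know that `R^{ps}_p` is in fact a component of the Bernstein centre
  of certain category of representations of `GL₂(ℚ_p)` (Theorem 1.5 of [Pas13])"; "a construction
  in the work of Paškūnas turns the completed homology into a finitely generated faithful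
  `𝕋`-module"; dimension `1 + 2[F:ℚ]` "if we are working with some totally real field `F` in
  which `p` completely splits". [cite: Pan2022, §1]
* X. Zhang, *Zariski density of modular points in the Eisenstein case*, arXiv:2512.21249, §1
  Step 1: "the natural map `⊗̂_{v∣p} R_v^{ps} → 𝕋_𝔪` induced by the universal property is finite";
  Rem. 1.2.9: "The most crucial one is that `p` splits completely in `F`. This is because
  Paškūnas theory (`p`-adic Langlands correspondence) is only established for `GL₂(ℚ_p)`."
  [cite: XZhang2025EisensteinDensity, §1 (Step 1) and Rem. 1.2.9]

## What this file states

* `FiniteCentreParametrisation k G C` — the TECHNIQUE CLASS (explicit Lean structure): for a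
  class `C` of `k`-representations of `G`, a commutative local ring `Z` ("the centre"), a ring
  `E` with `Algebra Z E` and `Module.Finite Z E` ("`Ẽ_𝔅`, finitely generated over its centre"),
  and an assignment `M` of a SIMPLE `E`-module to every member of `C` which reflects isomorphism
  (isomorphic modules only for isomorphic representations) — the shape of Paškūnas' block data
  `(𝒵_𝔅 ≅ R^{ps}, Ẽ_𝔅, π ↦ Hom_G(π, J_𝔅))` restricted to irreducible objects.  Noetherianity and
  completeness of `Z`, compactness of the modules, exactness of the functor are NOT required:
  dropping them only enlarges the class of data excluded, so the no-go below is the stronger for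
  it.
* `IsSupersingularOfSocleType ω S π` — the class `𝒞(ω, S)`: `π` smooth admissible irreducible,
  with central character `ω`, not a subquotient of a principal series (supersingular), and with
  `GL₂(𝒪_F)`-socle isomorphic to the `GL₂(𝒪_F)`-representation `S`.
* `PaskunasCentreFinitenessFails` (NAMED FACT, the printed theorem in block form): for `p ≠ 2`,
  `F/ℚ_p` unramified with residue field of cardinality `> p` (i.e. `f ≥ 2`), `k` an algebraic
  closure of `𝔽_p`, there are smooth admissible irreducible `k`-representations `π_i`
  (`i ∈ ℕ`) of `GL₂(F)`, pairwise non-isomorphic, with a common central character, all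
  supersingular, and with pairwise isomorphic `GL₂(𝒪_F)`-socles — Breuil–Paškūnas, Thm. 19.8
  (i)(a) and (ii) with Thm. 19.10 (i), for any generic irreducible `ρ̄` (these exist for
  `p ≥ 3`), the family `D(ρ̄, r)` being infinite for `f > 1` (§13).  It is
  `BreuilPaskunas2012_supersingularFamily` plus the socle clause
  (`PaskunasCentreFinitenessFails.supersingularFamily`); not proved here (SIZE XL, same printed
  proof as the parent fact: the whole memoir).
* PROVED: `exists_ne_nonempty_linearEquiv_of_isSimpleModule` (the algebraic engine: over a ring
  module-finite over a commutative local ring, any sequence of simple modules has two isomorphic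
  terms), `FiniteCentreParametrisation.exists_ne_nonempty_equiv` (hence any class carrying a
  finite-centre parametrisation has no infinite pairwise non-isomorphic family), and the typed
  no-go `PaskunasCentreFinitenessFails.isEmpty_finiteCentreParametrisation`: under the hypotheses
  of the fact there are `ω` and `S` such that `𝒞(ω, S)` contains an infinite pairwise
  non-isomorphic family and admits NO `FiniteCentreParametrisation`.

## Proof of the engine (elementary; [folklore])

Let `Z` be commutative local with maximal ideal `𝔪`, `E` a `Z`-algebra finite as a `Z`-module,
`S` a simple `E`-module.  `S = E·s` is finitely generated over `Z`, and `𝔪S` is an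
`E`-submodule (`Z` is central), so `𝔪S ∈ {0, S}`; Nakayama excludes `𝔪S = S`, hence `𝔪S = 0`
(`maximalIdeal_smul_eq_zero_of_isSimpleModule`).  Thus every simple module is a quotient of the
`E`-module `V = E/E𝔪`, which is finite over `Z`, killed by `𝔪`, hence a finite-dimensional
vector space over `Z/𝔪`, hence Artinian over `Z` and over `E`
(`isArtinian_quotient_map_maximalIdeal`).  Given simple `M₀, M₁, …` with surjections
`qᵢ : V ↠ Mᵢ`, put `Lₙ = ⋂_{i<n} ker qᵢ`.  If `Lₙ ≤ ker qₙ` then `Mₙ` is a quotient of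
`V/Lₙ ↪ ∏_{i<n} Mᵢ`, a semisimple module, so `Mₙ` is isomorphic to a simple submodule of
`∏_{i<n} Mᵢ`, i.e. to some `Mᵢ`, `i < n`.  So if the `Mᵢ` are pairwise non-isomorphic the chain
`L₀ > L₁ > ⋯` descends strictly for ever, contradicting the Artinian property.

## References

* [Pas2013] V. Paškūnas, Publ. Math. IHÉS 118 (2013) 1–191, §1.1, Thm. 1.5, Prop. 1.16,
  Thm. 1.17, §1.4. [cite: Paskunas2013, Thm. 1.5]
* [BP2012] C. Breuil, V. Paškūnas, Mem. AMS 216 (2012) no. 1016, §1 (pp. 3, 7, 9, 12), Def. 11.7,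
  §13 (p. 75, Def. 13.7, Thm. 13.8), Prop. 14.7, §16, Thm. 19.8, Thm. 19.10.
  [cite: BreuilPaskunas2012, Thm. 19.8 and Thm. 19.10]
* [BHHMS2023] C. Breuil, F. Herzig, Y. Hu, S. Morra, B. Schraen, Invent. Math. 234 (2023) 1–128,
  §1.1, Thm. 1.1, Thm. 1.2. [cite: BreuilEtAl2023, Thm. 1.1 and Thm. 1.2]
* [GN2022] T. Gee, J. Newton, J. Inst. Math. Jussieu 21 (2022) 395–458, §1. [cite: GeeNewton2020, §1]
* [Pan2022] L. Pan, J. Amer. Math. Soc. 35 (2022) 1031–1169, §1. [cite: Pan2022, §1]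
* [Zha2025] X. Zhang, arXiv:2512.21249 (2025), §1 Step 1, Rem. 1.2.9.
  [cite: XZhang2025EisensteinDensity, §1 (Step 1) and Rem. 1.2.9]
* [Bre2011] C. Breuil, Proc. ICM 2010 Vol. II (2011) 203–230, §3.2 (the `GL₂(𝒪_F)F^×`-socle,
  diagrams). [cite: Breuil2011, §3.2]
* [She2022] M. Sheth, Pacific J. Math. 321 (2022) 431–442, Thm. 3.2 ("all these representations
  have the same `K`-socle"; `p > 3`, any `F` with `f > 1`). [cite: Sheth2022, Thm. 3.2 and Cor. 3.3]
-/

open scoped ValuativeRel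
open IsLocalRing
open Literature.NumberTheory.Automorphic (glInt)

namespace Literature.Barriers.Langlands

/-! ## The algebraic engine: finitely many simple modules over an algebra finite over a local ring -/

section Engine

/-- Over a ring `E` which is a module-finite algebra over a commutative local ring `Z`, the maximal
ideal of `Z` kills every simple `E`-module: `𝔪 • S` is an `E`-submodule because `Z` is central,
it is not `S` by Nakayama (`S = E • s` is finitely generated over `Z`), so it is `0`. [folklore] -/
theorem maximalIdeal_smul_eq_zero_of_isSimpleModule {Z : Type*} [CommRing Z] [IsLocalRing Z]
    {E : Type*} [Ring E] [Algebra Z E] [Module.Finite Z E] {S : Type*} [AddCommGroup S]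
    [Module E S] [Module Z S] [IsScalarTower Z E S] [IsSimpleModule E S] {z : Z}
    (hz : z ∈ maximalIdeal Z) (x : S) : z • x = 0 := by
  have hnt : Nontrivial S := IsSimpleModule.nontrivial E S
  obtain ⟨s, hs⟩ := exists_ne (0 : S)
  have hfin : Module.Finite Z S :=
    Module.Finite.of_surjective ((LinearMap.toSpanSingleton E S s).restrictScalars Z)
      (IsSimpleModule.toSpanSingleton_surjective E hs)
  let N : Submodule Z S := maximalIdeal Z • ⊤
  let N' : Submodule E S :=
    { carrier := N
      add_mem' := fun ha hb => N.add_mem ha hb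
      zero_mem' := N.zero_mem
      smul_mem' := fun e x hx => by
        refine Submodule.smul_induction_on hx ?_ ?_
        · intro r hr n _
          rw [smul_comm e r n]
          exact Submodule.smul_mem_smul hr Submodule.mem_top
        · intro a b ha hb
          rw [smul_add]
          exact N.add_mem ha hb }
  rcases eq_bot_or_eq_top N' with h | h
  · have hmem : z • x ∈ N' :=
      (Submodule.smul_mem_smul hz (Submodule.mem_top : x ∈ (⊤ : Submodule Z S)) : z • x ∈ N)
    rw [h] at hmem
    exact (Submodule.mem_bot E).1 hmem
  · exfalso
    have htop : (⊤ : Submodule Z S) ≤ maximalIdeal Z • ⊤ := fun y _ =>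
      (show y ∈ N' by rw [h]; trivial : y ∈ N)
    have hbot := Submodule.eq_bot_of_le_smul_of_le_jacobson_bot (maximalIdeal Z) ⊤
      Module.Finite.fg_top htop (maximalIdeal_le_jacobson _)
    apply hs
    rw [← Submodule.mem_bot Z, ← hbot]
    trivial

/-- A finitely generated module over a commutative local ring which is killed by the maximal
ideal is Artinian: it is a vector space over the residue field, hence semisimple, and a finitely
generated semisimple module is Artinian. [folklore] -/
theorem isArtinian_of_isTorsionBySet_maximalIdeal (Z V : Type*) [CommRing Z] [IsLocalRing Z]
    [AddCommGroup V] [Module Z V] [Module.Finite Z V]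
    (htors : Module.IsTorsionBySet Z V (maximalIdeal Z)) : IsArtinian Z V := by
  letI : Field (Z ⧸ maximalIdeal Z) := Ideal.Quotient.field _
  letI : Module (Z ⧸ maximalIdeal Z) V := htors.module
  have h1 : IsSemisimpleModule (Z ⧸ maximalIdeal Z) V :=
    (isSemisimpleModule_iff _ _).mpr inferInstance
  haveI : IsSemisimpleModule Z V := htors.isSemisimpleModule_iff.mp h1
  infer_instance

/-- For `E` module-finite over the commutative local ring `Z` with maximal ideal `𝔪`, the quotient
of `E` by the left ideal `E𝔪` generated by the image of `𝔪` is an Artinian `E`-module (it is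
killed by `𝔪`, `Z` being central, and finitely generated over `Z`). [folklore] -/
theorem isArtinian_quotient_map_maximalIdeal (Z E : Type*) [CommRing Z] [IsLocalRing Z] [Ring E]
    [Algebra Z E] [Module.Finite Z E] :
    IsArtinian E (E ⧸ (Ideal.map (algebraMap Z E) (maximalIdeal Z) : Submodule E E)) := by
  have htors : Module.IsTorsionBySet Z
      (E ⧸ (Ideal.map (algebraMap Z E) (maximalIdeal Z) : Submodule E E)) (maximalIdeal Z) := by
    rintro v ⟨z, hz⟩
    induction v using Submodule.Quotient.induction_on with
    | H e =>
      change z • Submodule.Quotient.mk e = 0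
      rw [← Submodule.Quotient.mk_smul, Submodule.Quotient.mk_eq_zero, Algebra.smul_def,
        Algebra.commutes]
      exact Ideal.mul_mem_left _ e (Ideal.mem_map_of_mem _ hz)
  haveI : Module.Finite Z (E ⧸ (Ideal.map (algebraMap Z E) (maximalIdeal Z) : Submodule E E)) :=
    Module.Finite.trans E _
  exact isArtinian_of_tower Z (isArtinian_of_isTorsionBySet_maximalIdeal Z _ htors)

/-- **The engine.**  Over a ring `E` which is a module-finite algebra over a commutative local ring
`Z`, there is no sequence of pairwise non-isomorphic simple `E`-modules: among `M₀, M₁, …` simple,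
two are isomorphic.  (All `Mᵢ` are quotients of the Artinian module `V = E/E𝔪`; if the `Mᵢ` were
pairwise non-isomorphic the intersections `Lₙ = ⋂_{i<n} ker(V ↠ Mᵢ)` would descend strictly,
since `Lₙ ≤ ker(V ↠ Mₙ)` would make `Mₙ` a simple quotient, hence a simple submodule, of the
semisimple `V/Lₙ ↪ ∏_{i<n} Mᵢ`, i.e. isomorphic to some `Mᵢ`, `i < n`.)  Equivalently: `E` has
only finitely many simple modules up to isomorphism. [folklore] -/
theorem exists_ne_nonempty_linearEquiv_of_isSimpleModule (Z : Type*) [CommRing Z]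
    [IsLocalRing Z] {E : Type*} [Ring E] [Algebra Z E] [Module.Finite Z E] (M : ℕ → Type*)
    [∀ i, AddCommGroup (M i)] [∀ i, Module E (M i)] [∀ i, IsSimpleModule E (M i)] :
    ∃ i j, i ≠ j ∧ Nonempty (M i ≃ₗ[E] M j) := by
  classical
  by_contra hcon
  have hcon' : ∀ i j, i ≠ j → (M i ≃ₗ[E] M j) → False :=
    fun i j hij e => hcon ⟨i, j, hij, ⟨e⟩⟩
  letI : ∀ i, Module Z (M i) := fun i => Module.compHom (M i) (algebraMap Z E)
  haveI : ∀ i, IsScalarTower Z E (M i) := fun i =>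
    ⟨fun z e x => show (z • e) • x = algebraMap Z E z • (e • x) by
      rw [Algebra.smul_def, mul_smul]⟩
  have hnt : ∀ i, Nontrivial (M i) := fun i => IsSimpleModule.nontrivial E (M i)
  choose s hs using fun i => exists_ne (0 : M i)
  let I : Submodule E E := Ideal.map (algebraMap Z E) (maximalIdeal Z)
  let V := E ⧸ I
  have hle : ∀ i, I ≤ LinearMap.ker (LinearMap.toSpanSingleton E (M i) (s i)) := fun i => by
    change Ideal.map (algebraMap Z E) (maximalIdeal Z) ≤ _
    rw [Ideal.map_le_iff_le_comap]
    intro z hz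
    simp only [Ideal.mem_comap, LinearMap.mem_ker, LinearMap.toSpanSingleton_apply,
      algebraMap_smul]
    exact maximalIdeal_smul_eq_zero_of_isSimpleModule (E := E) hz (s i)
  let q : ∀ i, V →ₗ[E] M i := fun i => I.liftQ (LinearMap.toSpanSingleton E (M i) (s i)) (hle i)
  have hq : ∀ i, Function.Surjective (q i) := fun i => by
    rw [← LinearMap.range_eq_top, Submodule.range_liftQ, LinearMap.range_eq_top]
    exact IsSimpleModule.toSpanSingleton_surjective E (hs i)
  let K : ℕ → Submodule E V := fun i => LinearMap.ker (q i)
  let L : ℕ → Submodule E V := fun n => ⨅ i : Fin n, K i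
  have key : ∀ n, ¬ L n ≤ K n := fun n hLK => by
    let φ : V →ₗ[E] ((i : Fin n) → M i) := LinearMap.pi fun i => q i
    have hker : LinearMap.ker φ = L n := LinearMap.ker_pi _
    have e1 : (V ⧸ L n) ≃ₗ[E] LinearMap.range φ :=
      (Submodule.quotEquivOfEq _ _ hker.symm).trans φ.quotKerEquivRange
    haveI : IsSemisimpleModule E (V ⧸ L n) := IsSemisimpleModule.congr e1
    let g : (V ⧸ L n) →ₗ[E] M n := (L n).liftQ (q n) hLK
    have hg : g ≠ 0 := by
      intro h0
      obtain ⟨v, hv⟩ := hq n (s n)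
      apply hs n
      have : g (Submodule.Quotient.mk v) = q n v := Submodule.liftQ_apply _ _ _
      rw [← hv, ← this, h0, LinearMap.zero_apply]
    obtain ⟨S, ⟨eS⟩⟩ := LinearMap.linearEquiv_of_ne_zero hg
    let ι : (V ⧸ L n) →ₗ[E] ((i : Fin n) → M i) := (L n).liftQ φ hker.symm.le
    have hι : Function.Injective ι := by
      rw [← LinearMap.ker_eq_bot]
      exact Submodule.ker_liftQ_eq_bot _ _ _ hker.le
    let T : Submodule E ((i : Fin n) → M i) := S.map ι
    have eT : M n ≃ₗ[E] T := eS.trans (Submodule.equivMapOfInjective ι hι S)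
    haveI : IsSimpleModule E T := IsSimpleModule.congr eT.symm
    let sgl : Fin n → Submodule E ((i : Fin n) → M i) := fun i =>
      LinearMap.range (LinearMap.single E (fun i : Fin n => M i) i)
    have hinj : ∀ i : Fin n, Function.Injective (LinearMap.single E (fun i : Fin n => M i) i) :=
      fun i => Function.LeftInverse.injective (g := fun f => f i) fun x => by simp
    haveI hsimple : ∀ m : Set.range sgl, IsSimpleModule E m := by
      rintro ⟨_, i, rfl⟩
      exact IsSimpleModule.congr (LinearEquiv.ofInjective _ (hinj i)).symm
    have htop : sSup (Set.range sgl) = ⊤ := by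
      rw [sSup_range]
      exact LinearMap.iSup_range_single E _
    obtain ⟨m, ⟨i, rfl⟩, ⟨em⟩⟩ := Submodule.linearEquiv_of_sSup_eq_top T (Set.range sgl) htop
    have e : M n ≃ₗ[E] M (i : ℕ) :=
      eT.trans (em.trans (LinearEquiv.ofInjective _ (hinj i)).symm)
    exact hcon' n i (Nat.ne_of_gt i.isLt) e
  haveI : IsArtinian E V := isArtinian_quotient_map_maximalIdeal Z E
  have hanti : ∀ n, L (n + 1) < L n := fun n => by
    have hle' : L (n + 1) ≤ L n := le_iInf fun i => iInf_le_of_le (Fin.castSucc i) le_rfl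
    refine lt_of_le_of_ne hle' fun heq => key n ?_
    rw [← heq]
    exact iInf_le_of_le (Fin.last n) le_rfl
  obtain ⟨N, hN⟩ := IsArtinian.monotone_stabilizes (R := E) (M := V)
    ⟨fun n => OrderDual.toDual (L n), fun a b hab => by
      change L b ≤ L a
      exact (antitone_nat_of_succ_le fun n => (hanti n).le) hab⟩
  have := hN (N + 1) (Nat.le_succ N)
  exact (hanti N).ne (OrderDual.toDual.injective this).symm

end Engine

/-! ## The technique class: Paškūnas-type finite-centre parametrisations of a class of representations -/

section TechniqueClass

/-- **Technique class (D-0021): a finite-centre parametrisation** of a class `C` of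
`k`-representations of a group `G` — the shape of the structure Paškūnas puts on a block `𝔅` of
`GL₂(ℚ_p)`, `p ≥ 5`: the block is anti-equivalent to the compact modules over `Ẽ_𝔅 = End_G(J_𝔅)`,
`J_𝔅` an injective envelope of `⊕_{π ∈ 𝔅} π` (so irreducible `π ↦` the simple module
`Hom_G(π, J_𝔅)`, non-isomorphic to non-isomorphic), the
centre `𝒵_𝔅` of `Ẽ_𝔅` is the complete local noetherian ring `R^{ps,ζε}_{tr ρ̄}` and "`Ẽ_𝔅` is
finitely generated as a module over its centre" (Paškūnas 2013, §1.1 and Thm. 1.5; the general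
finiteness hypothesis of his Prop. 1.16 / Thm. 1.17 reads "the centre `𝒵` of `Ẽ` is noetherian
and `Ẽ` is a finitely generated `𝒵`-module").  The datum: a commutative LOCAL ring `Z`, a ring `E`
which is a `Z`-algebra (`Z` central) and finitely generated as a `Z`-module, and for every member
`π` of the class a SIMPLE `E`-module `M π`, such that `M π ≅ M π'` only if `π ≅ π'`.  Deliberately
NOT required (each omission enlarges the class of data and strengthens
`PaskunasCentreFinitenessFails.isEmpty_finiteCentreParametrisation`): `Z` noetherian or complete
or a `k`-algebra, `E` compact, `M` functorial or exact or defined beyond the irreducible objects.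
[cite: Paskunas2013, Thm. 1.5] -/
structure FiniteCentreParametrisation (k G : Type) [Field k] [Group G]
    (C : ∀ ⦃V : Type⦄ [AddCommGroup V] [Module k V], Representation k G V → Prop) : Type 1 where
  /-- The commutative local "centre". -/
  Z : Type
  [commRing : CommRing Z]
  [isLocalRing : IsLocalRing Z]
  /-- The (possibly non-commutative) algebra, finitely generated as a module over `Z`. -/
  E : Type
  [ring : Ring E]
  [algebra : Algebra Z E]
  [moduleFinite : Module.Finite Z E]
  /-- The simple `E`-module attached to each member of the class. -/
  M : ∀ ⦃V : Type⦄ [AddCommGroup V] [Module k V] (π : Representation k G V), C π → ModuleCat.{0} E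
  /-- Each attached module is simple. -/
  isSimpleModule : ∀ ⦃V : Type⦄ [AddCommGroup V] [Module k V] (π : Representation k G V)
    (h : C π), IsSimpleModule E (M π h)
  /-- The parametrisation reflects isomorphism. -/
  nonempty_equiv : ∀ ⦃V : Type⦄ [AddCommGroup V] [Module k V] ⦃V' : Type⦄ [AddCommGroup V']
    [Module k V'] (π : Representation k G V) (π' : Representation k G V') (h : C π) (h' : C π'),
    Nonempty (M π h ≃ₗ[E] M π' h') → Nonempty (π.Equiv π')

-- The bundled structures on the datum's OWN carriers `D.Z`, `D.E` (Mathlib's `ModuleCat.isModule`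
-- pattern); they apply to projections of `FiniteCentreParametrisation` only and override nothing.
attribute [instance] FiniteCentreParametrisation.commRing FiniteCentreParametrisation.isLocalRing
  FiniteCentreParametrisation.ring FiniteCentreParametrisation.algebra
  FiniteCentreParametrisation.moduleFinite

/-- A class of representations carrying a finite-centre parametrisation contains no infinite
family of pairwise non-isomorphic members: by the engine
(`exists_ne_nonempty_linearEquiv_of_isSimpleModule`) two of the attached simple modules are
isomorphic, and the parametrisation reflects isomorphism. [folklore] -/
theorem FiniteCentreParametrisation.exists_ne_nonempty_equiv {k G : Type} [Field k] [Group G]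
    {C : ∀ ⦃V : Type⦄ [AddCommGroup V] [Module k V], Representation k G V → Prop}
    (D : FiniteCentreParametrisation k G C) (V : ℕ → Type) [∀ i, AddCommGroup (V i)]
    [∀ i, Module k (V i)] (π : ∀ i, Representation k G (V i)) (hC : ∀ i, C (π i)) :
    ∃ i j, i ≠ j ∧ Nonempty ((π i).Equiv (π j)) := by
  haveI : ∀ i, IsSimpleModule D.E (D.M (π i) (hC i)) := fun i => D.isSimpleModule (π i) (hC i)
  obtain ⟨i, j, hij, ⟨e⟩⟩ :=
    exists_ne_nonempty_linearEquiv_of_isSimpleModule D.Z (E := D.E) fun i => D.M (π i) (hC i)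
  exact ⟨i, j, hij, D.nonempty_equiv _ _ _ _ ⟨e⟩⟩

end TechniqueClass

/-! ## The weight blocks of `GL₂(F)` and the barrier -/

section Barrier

variable {F : Type} [Field F] [ValuativeRel F] [TopologicalSpace F] [IsNonarchimedeanLocalField F]
variable {k : Type} [Field k]

/-- Restriction of a representation of `GL₂(F)` to `K = GL₂(𝒪_F)` (`glInt 2 F`, the image of
`GL₂(𝒪[F])`; Breuil–Paškūnas' `K`, §1 p. 12). [folklore] -/
noncomputable abbrev restrictGL2Int {V : Type} [AddCommGroup V] [Module k V]
    (π : Representation k (GL (Fin 2) F) V) : Representation k (glInt 2 F) V :=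
  π.comp (glInt 2 F).subtype

/-- **The class `𝒞(ω, S)`** of representations of `GL₂(F)` over `k` cut out by a central character
`ω` and a `K = GL₂(𝒪_F)`-socle type `S` (a `k`-representation of `K`): `π` is smooth admissible
and irreducible, has central character `ω`, is supersingular — not a subquotient of a principal
series `Ind_{B(F)}^{GL₂(F)} χ` (`IsSubquotientOfPrincipalSeries`; over `𝔽̄_p` this is
Barthel–Livné's notion, see the file `ModPLanglandsGL2BeyondQp`) — and its `K`-socle
(`Representation.socle` of the restriction to `K`, the sum of the irreducible
`K`-subrepresentations: Breuil–Paškūnas' `soc_K π`, §1 p. 3) is isomorphic to `S` as a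
representation of `K`.  For `S = ⊕_{σ ∈ 𝒟(ρ̄)} σ` and `ω` matching `det ρ̄` these are the
irreducible supersingular members of the "weight block" of a generic `ρ̄`.
[cite: BreuilPaskunas2012, Thm. 19.8 and Thm. 19.10] -/
def IsSupersingularOfSocleType (ω : Subgroup.center (GL (Fin 2) F) →* kˣ)
    {W : Type} [AddCommGroup W] [Module k W] (S : Representation k (glInt 2 F) W)
    ⦃V : Type⦄ [AddCommGroup V] [Module k V] (π : Representation k (GL (Fin 2) F) V) : Prop :=
  π.IsAdmissible ∧ π.IsIrreducible ∧ π.HasCentralCharacter ω ∧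
    ¬ IsSubquotientOfPrincipalSeries π ∧
    Nonempty ((restrictGL2Int π).socle.toRepresentation.Equiv S)

end Barrier

/-- **Barrier: Paškūnas' Bernstein-centre finiteness fails beyond `ℚ_p` — one weight block of
`GL₂(ℚ_{p^f})`, `f ≥ 2`, contains infinitely many supersingular representations
(Breuil–Paškūnas).**  Let `p ≠ 2` be prime, `F` a non-archimedean local field of characteristic
`0` with residue field of characteristic `p` and more than `p` elements, UNRAMIFIED over `ℚ_p`
(`𝓂[F] = (p)`; so `F = ℚ_{p^f}`, `f ≥ 2`), and `k` an algebraic closure of `𝔽_p`.  Then there are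
smooth admissible irreducible `k`-representations `π₀, π₁, …` of `GL₂(F)`, pairwise
non-isomorphic, with a common central character, none a subquotient of a principal series (all
supersingular), whose `GL₂(𝒪_F)`-socles are pairwise isomorphic `GL₂(𝒪_F)`-representations.
Printed proof: for a generic irreducible `ρ̄ : Gal(ℚ̄_p/ℚ_{p^f}) → GL₂(𝔽̄_p)` (Def. 11.7; such `ρ̄`
exist for every `p ≥ 3`, none for `p = 2`), twisted so that `p` acts trivially on `det ρ̄`, the
basic `0`-diagrams `D(ρ̄, r) = (D₀(ρ̄), D₁(ρ̄), r)` of §13 form a family which "when `f > 1` … is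
always infinite" (§13 p. 75; §1 p. 7; parameter counts §16); Thm. 19.8 (i) attaches to each a
smooth admissible `π` with (a) `soc_K π = ⊕_{σ ∈ 𝒟(ρ̄)} σ`, (b) `(π^{K₁}, π^{I₁}, can) ⊇ D(ρ̄, r)`,
(c) `π = ⟨G · D₀(ρ̄)⟩`; Thm. 19.8 (ii): non-isomorphic diagrams give non-isomorphic `π`;
Thm. 19.10 (i): each such `π` "is irreducible and is a supersingular representation"; all have
"fixed central character (matching `det(ρ)` via local class field theory)" (§1 p. 3), and all
have THE SAME `K`-socle `⊕_{σ ∈ 𝒟(ρ̄)} σ` by (a).  Supersingular = not a subquotient of a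
principal series over `𝔽̄_p` (Barthel–Livné; see `BreuilPaskunas2012_supersingularFamily`).  This
is `BreuilPaskunas2012_supersingularFamily` with the socle clause (a) retained
(`PaskunasCentreFinitenessFails.supersingularFamily`), i.e. the printed infinitude in BLOCK form;
its consequence for Bernstein-centre methods is the theorem
`PaskunasCentreFinitenessFails.isEmpty_finiteCentreParametrisation` proved below.  Not proved
here (SIZE XL: the printed proof is the memoir, as for the parent fact).
[cite: BreuilPaskunas2012, Thm. 19.8 and Thm. 19.10]

BARRIER (structured block, D-0021):
- technique_class: bernstein-centre paskunas-blocks pseudo-deformation-centre p-adic-local-langlands completed-homology-finiteness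
- blocks: transporting to places `v ∣ p` with `F_v ≠ ℚ_p` the arguments that control completed cohomology through Paškūnas' block theory of `GL₂(ℚ_p)` — the centre of a block is `R^{ps}` and `Ẽ_𝔅` is finite over it [cite: Paskunas2013, Thm. 1.5], whence "a construction in the work of Paškūnas turns the completed homology into a finitely generated faithful `𝕋`-module" and `dim 𝕋 ≥ 1 + 2[F:ℚ]` for "some totally real field `F` in which `p` completely splits" [cite: Pan2022, §1], and the finite map `⊗̂_{v∣p} R_v^{ps} → 𝕋_𝔪` of the Eisenstein-density argument, where "The most crucial [assumption] is that `p` splits completely in `F`. This is because Paškūnas theory … is only established for `GL₂(ℚ_p)`" [cite: XZhang2025EisensteinDensity, §1 (Step 1) and Rem. 1.2.9]; more generally any route needing, at `F_v = ℚ_{p^f}` with `f ≥ 2`, a `FiniteCentreParametrisation` of a class of representations containing a Breuil–Paškūnas family (`PaskunasCentreFinitenessFails.isEmpty_finiteCentreParametrisation`)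
- because: for `F = ℚ_{p^f}`, `f ≥ 2`, `p > 2` and a generic irreducible `ρ̄`, the `π` attached to the infinitely many non-isomorphic diagrams `D(ρ̄, r)` are pairwise non-isomorphic, irreducible, supersingular, with the same central character and the same `K`-socle `⊕_{σ ∈ 𝒟(ρ̄)} σ` [cite: BreuilPaskunas2012, Thm. 19.8 and Thm. 19.10], so the class `𝒞(ω, S)` they lie in is infinite; but a class parametrised injectively-up-to-isomorphism by simple modules over a ring `E` module-finite over a commutative local `Z` is finite — `𝔪_Z` kills every simple `E`-module (Nakayama), so the simples are quotients of the Artinian module `E/E𝔪_Z`, and pairwise non-isomorphic simple quotients of an Artinian module are finitely many (`exists_ne_nonempty_linearEquiv_of_isSimpleModule`, proved here); for `GL₂(ℚ_p)`, `p ≥ 5`, on the contrary, the blocks (i)–(iv) consist of at most three irreducibles each and `Ẽ_𝔅` is finite over its noetherian centre `R^{ps}` [cite: Paskunas2013, Thm. 1.5]; in Paškūnas' words "if `G ≠ GL₂(ℚ_p)` then there are too many representations of `G` to have a correspondence with Galois representations" (§1.4), in those of Breuil–Herzig–Hu–Morra–Schraen "if `F_v ≠ ℚ_p` the (over-)abundance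 of supersingular representations … makes it more difficult to obtain information" [cite: BreuilEtAl2023, §1.1]
- evasions_known: (i) replace the centre by the GELFAND–KIRILLOV DIMENSION: Gee–Newton reduce big `R = 𝕋` and flatness of patched completed homology to "the simple codimension inequality" via miracle flatness, an inequality which for `n = 2`, `F = ℚ` "follows from Emerton's `p`-adic local–global compatibility theorem, together with known properties of the `p`-adic local Langlands correspondence" and which in general "we do not know how to establish" [cite: GeeNewton2020, §1]; Breuil–Herzig–Hu–Morra–Schraen prove it — `dim_{GL₂(F_v)}(π) = f` — for `F_v` unramified and `ρ̄` generic, non-Eisenstein (absolutely irreducible on `G_{F(ζ_p)}`), and deduce `R_{ρ̄,S}^ψ ≅ 𝕋̂`, faithful flatness and complete intersection with no `p`-adic Langlands correspondence ("This flatness was known in the case of modular curves using the full strength of the `p`-adic Langlands correspondence for `GL₂(ℚ_p)`") [cite: BreuilEtAl2023, Thm. 1.1 and Thm. 1.2], the non-semisimple generic case being [cite: HuWang2020, Thm. 1.1]; (ii) cut the category down globally: Paškūnas' speculation that "a global setting, for example a Shimura curve, cuts out a full subcategory … closed under direct sums and subquotients" for which block finiteness holds, the formalism of his §§2–4 being written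 for arbitrary `p`-adic analytic `G` with this in view [cite: Paskunas2013, Thm. 1.5] (§1.4), and the "abelian subcategory of the category of smooth representations of `GL₂(F_v)` that has desirable finiteness property" announced in [cite: BreuilEtAl2023, §1.1]; (iii) stay where `F_v = ℚ_p`: `p` split completely in `F` [cite: Pan2022, §1], or pass to a finite abelian extension `F¹/F` in which `p` splits completely (potential pro-modularity) [cite: XZhang2025EisensteinDensity, §1 (Step 1) and Rem. 1.2.9]
- scope_caveats: the Lean statement asserts only the EXISTENCE of one central character `ω` and one `K`-socle type `S` carrying an infinite pairwise non-isomorphic family of irreducible admissible supersingular representations (the printed witnesses: every generic irreducible `ρ̄`, `S = ⊕_{σ ∈ 𝒟(ρ̄)} σ`, `ω ↔ det ρ̄` with `p ↦ 1`; for `ρ̄` reducible split the analogous families `π_ℓ` of Thm. 19.9 / 19.10 (ii) are not recorded here), for `F` unramified over `ℚ_p` with `f ≥ 2`, `p > 2`, coefficients `𝔽̄_p` [cite: BreuilPaskunas2012, Thm. 19.8 and Thm. 19.10] (for `p > 3` and ANY `F` with `f > 1`, ramified included, an infinite supersingular family with "the same `K`-socle" is printed in [cite: Sheth2022, Thm.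 3.2 and Cor. 3.3], not used here); the proved no-go excludes parametrisations of the class `𝒞(ω, S)` (and of any larger class) by simple modules over an algebra module-finite over a commutative LOCAL ring reflecting isomorphism — it does not assert that the `Ext¹`-block of a given `π` in Paškūnas' sense is infinite (the extensions between the Breuil–Paškūnas `π` are not computed in print), nor that finiteness fails on smaller, globally cut-out subcategories [cite: Paskunas2013, Thm. 1.5] (§1.4), nor anything over a non-local (e.g. merely noetherian) base; nothing is said for `F = ℚ_p`, where for `p ≥ 5` the blocks are finite and the finiteness holds [cite: Paskunas2013, Thm. 1.5], nor for `p = 2` (no generic `ρ̄`) [cite: BreuilPaskunas2012, §11]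
- status: established [cite: BreuilPaskunas2012, Thm. 19.8 and Thm. 19.10] [cite: Paskunas2013, Thm. 1.5] -/
def PaskunasCentreFinitenessFails : Prop :=
  ∀ (p : ℕ) [Fact p.Prime], p ≠ 2 →
  ∀ (F : Type) [Field F] [ValuativeRel F] [TopologicalSpace F] [IsNonarchimedeanLocalField F],
    CharZero F → CharP 𝓀[F] p → p < Nat.card 𝓀[F] →
    𝓂[F] = Ideal.span {(p : 𝒪[F])} →
  ∀ (k : Type) [Field k] [Algebra (ZMod p) k] [IsAlgClosure (ZMod p) k],
    ∃ (V : ℕ → Type) (_ : ∀ i, AddCommGroup (V i)) (_ : ∀ i, Module k (V i))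
      (π : ∀ i, Representation k (GL (Fin 2) F) (V i)),
      (∀ i, (π i).IsAdmissible ∧ (π i).IsIrreducible) ∧
      (∀ i j, i ≠ j → IsEmpty ((π i).Equiv (π j))) ∧
      (∃ ω : Subgroup.center (GL (Fin 2) F) →* kˣ, ∀ i, (π i).HasCentralCharacter ω) ∧
      (∀ i, ¬ IsSubquotientOfPrincipalSeries (π i)) ∧
      (∀ i j, Nonempty ((restrictGL2Int (π i)).socle.toRepresentation.Equiv
        (restrictGL2Int (π j)).socle.toRepresentation))

/-- The block form refines the catalogued fact: forgetting the socle clause gives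
`BreuilPaskunas2012_supersingularFamily` (same hypotheses, same first four conclusions). [folklore] -/
theorem PaskunasCentreFinitenessFails.supersingularFamily (h : PaskunasCentreFinitenessFails) :
    BreuilPaskunas2012_supersingularFamily := by
  intro p _ hp F _ _ _ _ hF hchar hcard hunr k _ _ _
  obtain ⟨V, hV, hV', π, hirr, hne, hω, hss, -⟩ := h p hp F hF hchar hcard hunr k
  exact ⟨V, hV, hV', π, hirr, hne, hω, hss⟩

/-- **The typed no-go (consequence of the barrier, PROVED).**  Under the hypotheses of
`PaskunasCentreFinitenessFails` (`p ≠ 2`, `F = ℚ_{p^f}` unramified with `f ≥ 2`, `k = 𝔽̄_p`)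
there are a central character `ω` of `GL₂(F)` and a `GL₂(𝒪_F)`-representation `S` such that the
class `𝒞(ω, S)` of smooth admissible irreducible supersingular representations with central
character `ω` and `GL₂(𝒪_F)`-socle `≅ S` (`IsSupersingularOfSocleType ω S`) contains an infinite
family of pairwise non-isomorphic representations AND admits no finite-centre parametrisation
(`FiniteCentreParametrisation`): there is no commutative local ring `Z`, no `Z`-algebra `E`
finitely generated as a `Z`-module, and no assignment of simple `E`-modules to the members of
`𝒞(ω, S)` under which non-isomorphic representations receive non-isomorphic modules — in
particular nothing of the shape of Paškūnas' `GL₂(ℚ_p)` block data (`𝒵_𝔅 ≅ R^{ps}` noetherian,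
`Ẽ_𝔅` finite over `𝒵_𝔅`, `π ↦ Hom_G(π, J_𝔅)`) on any class of representations containing
`𝒞(ω, S)`.  Proof: the family of the fact lies in `𝒞(ω, S)` for `ω` its common central character
and `S` the socle of its first member; apply `FiniteCentreParametrisation.exists_ne_nonempty_equiv`.
[cite: BreuilPaskunas2012, Thm. 19.8 and Thm. 19.10] -/
theorem PaskunasCentreFinitenessFails.isEmpty_finiteCentreParametrisation
    (h : PaskunasCentreFinitenessFails) :
    ∀ (p : ℕ) [Fact p.Prime], p ≠ 2 →
    ∀ (F : Type) [Field F] [ValuativeRel F] [TopologicalSpace F] [IsNonarchimedeanLocalField F],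
      CharZero F → CharP 𝓀[F] p → p < Nat.card 𝓀[F] →
      𝓂[F] = Ideal.span {(p : 𝒪[F])} →
    ∀ (k : Type) [Field k] [Algebra (ZMod p) k] [IsAlgClosure (ZMod p) k],
      ∃ (ω : Subgroup.center (GL (Fin 2) F) →* kˣ) (W : Type) (_ : AddCommGroup W)
        (_ : Module k W) (S : Representation k (glInt 2 F) W),
        (∃ (V : ℕ → Type) (_ : ∀ i, AddCommGroup (V i)) (_ : ∀ i, Module k (V i))
            (π : ∀ i, Representation k (GL (Fin 2) F) (V i)),
            (∀ i, IsSupersingularOfSocleType ω S (π i)) ∧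
            ∀ i j, i ≠ j → IsEmpty ((π i).Equiv (π j))) ∧
        IsEmpty (FiniteCentreParametrisation k (GL (Fin 2) F) (IsSupersingularOfSocleType ω S)) := by
  intro p _ hp F _ _ _ _ hF hchar hcard hunr k _ _ _
  obtain ⟨V, hV, hV', π, hirr, hne, ⟨ω, hω⟩, hss, hsoc⟩ := h p hp F hF hchar hcard hunr k
  have hC : ∀ i, IsSupersingularOfSocleType ω (restrictGL2Int (π 0)).socle.toRepresentation
      (π i) :=
    fun i => ⟨(hirr i).1, (hirr i).2, hω i, hss i, hsoc i 0⟩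
  refine ⟨ω, _, inferInstance, inferInstance, (restrictGL2Int (π 0)).socle.toRepresentation,
    ⟨V, hV, hV', π, hC, hne⟩, ⟨fun D => ?_⟩⟩
  obtain ⟨i, j, hij, ⟨e⟩⟩ := D.exists_ne_nonempty_equiv V π hC
  exact (hne i j hij).false e

end Literature.Barriers.Langlands
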